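import Summits.CriticalPhenomena.PercolationContinuityZ3.Theorems.PercRayRenewalJumpLineAvoidanceDecayVoidSecondMoment
import Literature.Probability.Percolation.TwoPointFunction
import HarnessLib

/-!
# A power saving in the ball sum of the connected two-point function forces box-void decay

Route `PercRayRenewal`, item `JumpLineAvoidanceDecay` (stmt-CriticalPhenomena-4626), helper file.
For nearest-neighbour bond percolation on `ℤ³` at ANY density `p` with `θ(p) > 0`: if the ball
sums of the connected two-point function `τ_p(0, z) - θ(p)²` (`τ_p(x, y) = P_p(x ↔ y)`) enjoy an
"infrared-type" power saving over the volume,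
`Σ_{z ∈ Λ_R} (τ_p(0, z) - θ(p)²) ≤ C R^{3-a}` for all `R ≥ 1` (some `a > 0`,
`Λ_R = {-R, …, R}³`), then the probability that the box `Λ_r` avoids the infinite cluster decays
like a power: `P_p(Λ_r ∩ C_∞ = ∅) ≤ (8 max(C,0) / θ(p)²) · r^{-a}` for all `r ≥ 1`.

Proof (Chebyshev / second moment on the box). The second-moment void bound
`real_void_mul_sq_le_sum_openConn_sub` (sibling file `…VoidSecondMoment`) applied to `T = Λ_r`
(`|Λ_r| = (2r+1)³`, `card_box`) gives
`P_p(Λ_r ∩ C_∞ = ∅) · (θ (2r+1)³)² ≤ Σ_{x, y ∈ Λ_r} (τ_p(x, y) - θ²)`. For fixed `x ∈ Λ_r`,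
translation invariance `τ_p(x, y) = τ_p(0, y - x)` (`tau_eq_tau_zero_sub`), injectivity of
`y ↦ y - x : Λ_r → Λ_{2r}` and non-negativity of every term `τ_p(0, z) - θ² ≥ 0`
(`Grimmett1999_theta_sq_le_openConn_holds`) bound the row sum by
`Σ_{z ∈ Λ_{2r}} (τ_p(0, z) - θ²) ≤ C (2r)^{3-a} ≤ 8 max(C,0) r³ r^{-a}`. Summing over the
`(2r+1)³` rows and using `r³ ≤ (2r+1)³`,
`P_p(Λ_r ∩ C_∞ = ∅) θ² (2r+1)⁶ ≤ 8 max(C,0) (2r+1)⁶ r^{-a}`.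

## References

* G. Grimmett, *Percolation*, 2nd ed., Springer 1999, §8.5 p. 213 (`τ_p(x,y) ≥ θ(p)²`,
  uniqueness), §1.6 (translation invariance) [GrimmettPercolation1999].
-/

noncomputable section

namespace Summit.CriticalPhenomena.PercolationContinuityZ3.Theorems

open MeasureTheory Literature.Probability.Percolation Literature.Probability.LatticeModels

namespace BallSecondMoment

/-- **Row sums.** For `x ∈ Λ_r = {-r, …, r}^d`: by translation invariance
`τ_p(x, y) = τ_p(0, y - x)` (`tau_eq_tau_zero_sub`), injectivity of `y ↦ y - x`, the elementary
inclusion `Λ_r - Λ_r ⊆ Λ_{2r}` and non-negativity of the connected two-point function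
`τ_p(0, z) - θ(p)² ≥ 0` (`Grimmett1999_theta_sq_le_openConn_holds`),
`Σ_{y ∈ Λ_r} (τ_p(x, y) - θ²) ≤ Σ_{z ∈ Λ_{2r}} (τ_p(0, z) - θ²)`. [folklore] -/
theorem sum_box_openConn_sub_sq_le (d : ℕ) (p : unitInterval) {r : ℕ} {x : Site d}
    (hx : x ∈ box d r) :
    ∑ y ∈ box d r, ((bondPercolation (zdGraph d) p).real (openConn x y) -
        theta (zdGraph d) (0 : Site d) p ^ 2) ≤
      ∑ z ∈ box d (2 * r), ((bondPercolation (zdGraph d) p).real (openConn (0 : Site d) z) -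
        theta (zdGraph d) (0 : Site d) p ^ 2) := by
  have hinj : Set.InjOn (fun y : Site d => y - x) ↑(box d r) :=
    fun y _ y' _ h => sub_left_inj.mp h
  -- `Λ_r - Λ_r ⊆ Λ_{2r}`, coordinatewise
  have hsub : (box d r).image (fun y : Site d => y - x) ⊆ box d (2 * r) := by
    refine Finset.image_subset_iff.2 fun y hy => ?_
    rw [mem_box] at hx hy ⊢
    intro i
    have h1 := hx i
    have h2 := hy i
    simp only [Pi.sub_apply]
    push_cast
    omega
  calc ∑ y ∈ box d r, ((bondPercolation (zdGraph d) p).real (openConn x y) -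
          theta (zdGraph d) (0 : Site d) p ^ 2)
      = ∑ y ∈ box d r, ((bondPercolation (zdGraph d) p).real (openConn (0 : Site d) (y - x)) -
          theta (zdGraph d) (0 : Site d) p ^ 2) :=
        Finset.sum_congr rfl fun y _ =>
          congrArg (fun t : ℝ => t - theta (zdGraph d) (0 : Site d) p ^ 2)
            (tau_eq_tau_zero_sub p x y)
    _ = ∑ z ∈ (box d r).image (fun y : Site d => y - x),
          ((bondPercolation (zdGraph d) p).real (openConn (0 : Site d) z) -
            theta (zdGraph d) (0 : Site d) p ^ 2) :=
        (Finset.sum_image (f := fun z : Site d =>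
          (bondPercolation (zdGraph d) p).real (openConn (0 : Site d) z) -
            theta (zdGraph d) (0 : Site d) p ^ 2) hinj).symm
    _ ≤ ∑ z ∈ box d (2 * r), ((bondPercolation (zdGraph d) p).real (openConn (0 : Site d) z) -
          theta (zdGraph d) (0 : Site d) p ^ 2) :=
        Finset.sum_le_sum_of_subset_of_nonneg hsub fun z _ _ =>
          sub_nonneg.2 (Grimmett1999_theta_sq_le_openConn_holds d p 0 z)

end BallSecondMoment

open BallSecondMoment in
/-- **Ball two-point power saving ⇒ box-void decay** (any `p` with `θ(p) > 0`, `d = 3`): if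
`Σ_{z ∈ Λ_R} (τ_p(0, z) - θ(p)²) ≤ C R^{3-a}` for all `R ≥ 1` (some `a > 0`), then
`P_p(Λ_r ∩ C_∞ = ∅) ≤ (8 max(C,0) / θ(p)²) · r^{-a}` for all `r ≥ 1`. Second moment on the box
(`real_void_mul_sq_le_sum_openConn_sub` with `T = Λ_r`, `|Λ_r| = (2r+1)³`), the row-sum estimate
`BallSecondMoment.sum_box_openConn_sub_sq_le`, the hypothesis at `R = 2r`, and the bookkeeping
`(2r)^{3-a} ≤ 8 r³ r^{-a}`, `r³ ≤ (2r+1)³`. [folklore] -/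
theorem boxVoidDecay_of_ballTwoPointPowerSaving (p : unitInterval)
    (hθ : 0 < theta (zdGraph 3) (0 : Site 3) p)
    (hIR : ∃ a C : ℝ, 0 < a ∧ ∀ R : ℕ, 1 ≤ R →
      ∑ x ∈ box 3 R, ((bondPercolation (zdGraph 3) p).real (openConn (0 : Site 3) x) -
        theta (zdGraph 3) (0 : Site 3) p ^ 2) ≤ C * (R : ℝ) ^ (3 - a)) :
    ∃ b C : ℝ, 0 < b ∧ ∀ r : ℕ, 1 ≤ r →
      (bondPercolation (zdGraph 3) p).real {ω | ∀ x ∈ box 3 r, ω ∉ percolatesAt x} ≤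
        C * (r : ℝ) ^ (-b) := by
  obtain ⟨a, C, ha, hC⟩ := hIR
  refine ⟨a, 8 * max C 0 / theta (zdGraph 3) (0 : Site 3) p ^ 2, ha, fun r hr => ?_⟩
  have hr0 : (0 : ℝ) < r := by exact_mod_cast hr
  have hK0 : 0 ≤ max C 0 := le_max_right _ _
  -- the second-moment void bound on `T = Λ_r`, with `N = |Λ_r| = (2r+1)³ ≥ r³`
  have key := real_void_mul_sq_le_sum_openConn_sub 3 p (box 3 r)
  obtain ⟨N, hN⟩ : ∃ N : ℝ, ((box 3 r).card : ℝ) = N := ⟨_, rfl⟩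
  rw [hN] at key
  have hrN : (r : ℝ) ^ (3 : ℕ) ≤ N := by
    rw [← hN, card_box]
    exact_mod_cast Nat.pow_le_pow_left (by omega : r ≤ 2 * r + 1) 3
  have hN0 : 0 < N := lt_of_lt_of_le (pow_pos hr0 3) hrN
  -- row sums and the hypothesis at `R = 2r`
  have hrows : ∑ x ∈ box 3 r, ∑ y ∈ box 3 r,
      ((bondPercolation (zdGraph 3) p).real (openConn x y) -
        theta (zdGraph 3) (0 : Site 3) p ^ 2) ≤
      N * (C * ((2 * r : ℕ) : ℝ) ^ (3 - a)) :=
    calc ∑ x ∈ box 3 r, ∑ y ∈ box 3 r,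
          ((bondPercolation (zdGraph 3) p).real (openConn x y) -
            theta (zdGraph 3) (0 : Site 3) p ^ 2)
        ≤ ∑ _x ∈ box 3 r, C * ((2 * r : ℕ) : ℝ) ^ (3 - a) :=
          Finset.sum_le_sum fun x hx =>
            (sum_box_openConn_sub_sq_le 3 p hx).trans (hC (2 * r) (by omega))
      _ = N * (C * ((2 * r : ℕ) : ℝ) ^ (3 - a)) := by
          rw [Finset.sum_const, nsmul_eq_mul, hN]
  -- `(2r)^{3-a} ≤ 8 · r³ · r^{-a}`
  have h2r : ((2 * r : ℕ) : ℝ) ^ (3 - a) ≤ 8 * ((r : ℝ) ^ (3 : ℕ) * (r : ℝ) ^ (-a)) := by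
    have e1 : ((2 * r : ℕ) : ℝ) ^ (3 - a) = (2 : ℝ) ^ (3 - a) * (r : ℝ) ^ (3 - a) := by
      push_cast
      exact Real.mul_rpow (by norm_num) hr0.le
    have e2 : (2 : ℝ) ^ (3 - a) ≤ 8 :=
      calc (2 : ℝ) ^ (3 - a) ≤ (2 : ℝ) ^ (3 : ℝ) :=
            Real.rpow_le_rpow_of_exponent_le (by norm_num) (by linarith)
        _ = 8 := by
            rw [Real.rpow_ofNat]
            norm_num
    have e3 : (r : ℝ) ^ (3 - a) = (r : ℝ) ^ (3 : ℕ) * (r : ℝ) ^ (-a) := by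
      rw [sub_eq_add_neg, Real.rpow_add hr0, Real.rpow_ofNat]
    rw [e1, e3]
    exact mul_le_mul_of_nonneg_right e2 (by positivity)
  -- assemble: `v θ² N² ≤ 8 max(C,0) r^{-a} N²`
  have h3 : (bondPercolation (zdGraph 3) p).real {ω | ∀ x ∈ box 3 r, ω ∉ percolatesAt x} *
        theta (zdGraph 3) (0 : Site 3) p ^ 2 * N ^ 2 ≤
      8 * max C 0 * (r : ℝ) ^ (-a) * N ^ 2 :=
    calc (bondPercolation (zdGraph 3) p).real {ω | ∀ x ∈ box 3 r, ω ∉ percolatesAt x} *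
          theta (zdGraph 3) (0 : Site 3) p ^ 2 * N ^ 2
        = (bondPercolation (zdGraph 3) p).real {ω | ∀ x ∈ box 3 r, ω ∉ percolatesAt x} *
            (theta (zdGraph 3) (0 : Site 3) p * N) ^ 2 := by ring
      _ ≤ _ := key
      _ ≤ N * (C * ((2 * r : ℕ) : ℝ) ^ (3 - a)) := hrows
      _ ≤ N * (max C 0 * ((2 * r : ℕ) : ℝ) ^ (3 - a)) :=
          mul_le_mul_of_nonneg_left
            (mul_le_mul_of_nonneg_right (le_max_left _ _)
              (Real.rpow_nonneg (Nat.cast_nonneg _) _)) hN0.le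
      _ ≤ N * (max C 0 * (8 * ((r : ℝ) ^ (3 : ℕ) * (r : ℝ) ^ (-a)))) :=
          mul_le_mul_of_nonneg_left (mul_le_mul_of_nonneg_left h2r hK0) hN0.le
      _ ≤ N * (max C 0 * (8 * (N * (r : ℝ) ^ (-a)))) :=
          mul_le_mul_of_nonneg_left (mul_le_mul_of_nonneg_left
            (mul_le_mul_of_nonneg_left
              (mul_le_mul_of_nonneg_right hrN (Real.rpow_nonneg hr0.le _)) (by norm_num))
            hK0) hN0.le
      _ = 8 * max C 0 * (r : ℝ) ^ (-a) * N ^ 2 := by ring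
  have h4 : (bondPercolation (zdGraph 3) p).real {ω | ∀ x ∈ box 3 r, ω ∉ percolatesAt x} *
        theta (zdGraph 3) (0 : Site 3) p ^ 2 ≤ 8 * max C 0 * (r : ℝ) ^ (-a) :=
    le_of_mul_le_mul_right h3 (pow_pos hN0 2)
  rw [div_mul_eq_mul_div, le_div_iff₀ (pow_pos hθ 2)]
  exact h4

end Summit.CriticalPhenomena.PercolationContinuityZ3.Theorems

end
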